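import Summits.ResolutionOfSingularities.ResolutionOfSingularities.Theorems.WeightedInvariantContactCylinderOpenPresentation
import Summits.ResolutionOfSingularities.ResolutionOfSingularities.Theorems.WeightedInvariantContactCylinderDefs
import Summits.ResolutionOfSingularities.ResolutionOfSingularities.Theorems.WeightedInvariantIotaOrderHusc
import Summits.ResolutionOfSingularities.ResolutionOfSingularities.Theorems.WeightedInvariantStratumIffModels
import HarnessLib

/-!
# The (open″) clause BODY at P3a positions for the cylinder pair `(ι, jCylinder ι jContact)` — ORDER (o28) (o28-O)
# (door `HypersurfaceCentreConstruction`, stmt-ResolutionOfSingularities-19897; KEY `stub_localWeightedDropEFT4S` beyond the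
# P2 rung, regime P3a «the top stratum through the closed point is a regular germ of codimension two»)

Topic: `Summits/ResolutionOfSingularities/ResolutionOfSingularities/Theorems`. Helper for the door item
`HypersurfaceCentreConstruction` (stmt-ResolutionOfSingularities-19897, route `WeightedInvariant`), line `local-engine` of
res-L1-w43-plan-1 (L W4.3), ORDER (o28) (lead res-type-005, co-hand res-D-brk-1).  The P3 analogue of res-type-098's (o24-O)
engine `GenericEquimultiplicity.jOpenPresentationForallSingLE2_body_of_strat_maximalIdeal` (p516179): the ∃-body of the (open″)
clause `JOpenPresentationForallSingLE d` (res-type-061, p522114) at a MODEL position `(A, 𝔪, F)` of regime P3a, for the pair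
`(ι, J₃)` with `J₃ := jCylinder ι jContact` (res-type-005's (D1), p524206), `U = (x, g)`, `W = (1, b_max)`.

THE POSITION (hypotheses).  `k` perfect, `A` of finite type over `k`, primes `𝔭 ≤ 𝔪` with `A_𝔪`, `A_𝔭` regular,
`dim A_𝔭 = 2`; `x, g ∈ A` with `(x, g) A_𝔭 = 𝔪_{A_𝔭}` (a regular system of parameters of the P2 object `A_𝔭` chosen in `A`),
`(x, g) A_𝔪 = 𝔭 A_𝔪` and `(x/1, g/1)` with independent differentials in `A_𝔪` (the stratum `V(𝔭)` is a regular germ of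
codimension two at `𝔪` cut out by `x, g`); the P2 data at `A_𝔭` (`F/1 ≠ 0` NOT of monomial type, `g/1` a contact parameter
reaching the terminal level `b_max`); and the ι-SIDE on a basic open `D(h₁) ∋ 𝔪`: the STRATUM IFF
`𝔭 ≤ 𝔮 ↔ (F ∈ 𝔪_{A_𝔮}² ∧ ι (A_𝔮) F = ι (A_𝔪) F)` (the conclusion shape of `StratumIff.stratumIff_iota_of_strat`, i.e. of the
local (strat)+(adm) conjuncts at `A_𝔪` spread out; for `ι = iotaOrd` it is `GenericEquimultiplicity.stratumIff_iotaOrd`,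
p515109) together with «`ι (A_𝔮) F = ι (A_𝔪) F → F ∈ 𝔪_{A_𝔮}²`» (automatic for any `ι` beginning with the order).

THE CONCLUSION.  There is `h ∉ 𝔪` such that at every prime `𝔮 ∈ D(h)` (NO dimension guard needed):
`(x ∈ 𝔮 ∧ g ∈ 𝔮) ↔ (F ∈ 𝔪_{A_𝔮}² ∧ ι (A_𝔮) F = ι (A_𝔪) F)`, and if `x, g ∈ 𝔮` then for every `m`
`jCylinder ι jContact (A_𝔮) (F/1) m = (x, g; 1, b_max)_m · A_𝔮`.
Route: the `V(U)`-form of the stratum iff (`StratumIff.stratumIff_forall_mem_of_comap_of_pos`); at `𝔮 ∈ V(𝔭) ∩ D(h)` the top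
`ι`-stratum of `A_𝔮` is `V(𝔭 A_𝔮)` (the iff read at the primes `𝔮₀ ⊆ 𝔮` through `(A_𝔮)_{𝔮₀ A_𝔮} ≃ A_{𝔮₀}`,
`StratumIff.iota_localization_localization_eq`), so `jCylinder` is the cylinder over `𝔭 A_𝔮` (`jCylinder_eq_of_topStratum_eq`),
whose value is `(x, g; 1, b_max)_m · A_𝔮` by `cylinder_open_presentation_of_essFiniteType` (p524363) — regularity of `A_𝔮` and
independence of `(x/1, g/1)` there being spread from `𝔪` by Literature `CotangentIndependenceSpread`.

## Contents (sorry-free, standard axioms; NO definitions)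

* `comap_le_of_isPrime_atPrime` — a prime of `A_𝔮` contracts into `𝔮`.
* `topStratum_atPrime_eq_of_stratumIff` — the top `ι`-stratum of `A_𝔮` is `V(𝔭 A_𝔮)` at `𝔮 ∈ V(𝔭) ∩ D(h₁ h₂)`.
* **`jOpenPresentation_body_cylinder`** — the body above, `ι`-generic (`IotaIsoInvariant ι` + the two ι-side inputs).
* **`jOpenPresentation_body_cylinder_iotaOrd`** — `ι = iotaOrd`: both ι-side inputs DISCHARGED from the local (strat)
  conjunct at `A_𝔪` (res-type-073's form) via `GenericEquimultiplicity.stratumIff_iotaOrd` and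
  `StratumIff.mem_sq_iff_two_le_iotaOrd`.

[OURS · L1 W4.3 · (o28) P3a probe]  Replaces the role of NO printed item; NOT a statement of the manuscript
[claim: Hironaka2017, status: under-review]. AI work, weaker than expert review.  Pure commutative algebra; no named facts.

## References

* V. Cossart, O. Piltant, *Resolution of singularities of threefolds in positive characteristic I*, J. Algebra 320 (2008),
  Prop. 4.2 (proof: generic behaviour of the order along a regular prime). [CossartPiltant2008]
* H. Matsumura, *Commutative Ring Theory* (1987), Thm. 4.3, 14.2, §30. [Matsumura1987]
* res-type-005, `plan/tools/res-type-005/o28/P3A-PROBE.md` v2 (OURS, AI design input).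
-/

noncomputable section

open IsLocalRing Literature.AlgebraicGeometry.Resolution
open Summit.ResolutionOfSingularities.ResolutionOfSingularities.Cruxes.HypersurfaceCentreConstruction.LocalEngine

set_option linter.dupNamespace false -- mandated namespace of this single-conjunct summit

namespace Summit.ResolutionOfSingularities.ResolutionOfSingularities.Theorems

namespace ContactCylinder

/-! ## The top `ι`-stratum of `A_𝔮` along the stratum -/

/-- A prime of the localisation `A_𝔮` contracts into `𝔮`. [folklore] -/
theorem comap_le_of_isPrime_atPrime {A : Type} [CommRing A] (𝔮 : Ideal A) [𝔮.IsPrime]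
    (Q : Ideal (Localization.AtPrime 𝔮)) [Q.IsPrime] :
    Q.comap (algebraMap A (Localization.AtPrime 𝔮)) ≤ 𝔮 := by
  intro a ha
  rw [← Localization.AtPrime.under_maximalIdeal (I := 𝔮)]
  exact Ideal.comap_mono (IsLocalRing.le_maximalIdeal (Ideal.IsPrime.ne_top ‹_›)) ha

/-- **The top `ι`-stratum of `A_𝔮` is `V(𝔭 A_𝔮)` at the points `𝔮 ⊇ 𝔭` of a basic open carrying the stratum iff.**
`ι` iso-invariant; on `D(h₁)`: `𝔭 ≤ 𝔮₀ ↔ (F ∈ 𝔪_{A_𝔮₀}² ∧ ι (A_𝔮₀) F = ι (A_𝔪) F)`; on `D(h₂)`: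
`ι (A_𝔮₀) F = ι (A_𝔪) F → F ∈ 𝔪_{A_𝔮₀}²`.  Then for `𝔮 ⊇ 𝔭` with `h₁, h₂ ∉ 𝔮`:
`topStratum ι (A_𝔮) (F/1) = {𝔮₀' | 𝔭 A_𝔮 ≤ 𝔮₀'}` (the primes `𝔮₀'` of `A_𝔮` are the primes `𝔮₀ ⊆ 𝔮`, with
`(A_𝔮)_{𝔮₀'} ≃ A_{𝔮₀}` carrying `ι`). [OURS · L1 W4.3 · (o28)] -/
theorem topStratum_atPrime_eq_of_stratumIff (ι : (R : Type) → [CommRing R] → R → Ordinal.{0}) (hiso : IotaIsoInvariant ι)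
    {A : Type} [CommRing A] (𝔪 𝔭 : Ideal A) [𝔪.IsPrime] [𝔭.IsPrime] (F : A) {h₁ h₂ : A}
    (hiff : ∀ (𝔮 : Ideal A) [𝔮.IsPrime], h₁ ∉ 𝔮 →
      (𝔭 ≤ 𝔮 ↔ (algebraMap A (Localization.AtPrime 𝔮) F ∈ maximalIdeal (Localization.AtPrime 𝔮) ^ 2 ∧
        ι (Localization.AtPrime 𝔮) (algebraMap A (Localization.AtPrime 𝔮) F) =
          ι (Localization.AtPrime 𝔪) (algebraMap A (Localization.AtPrime 𝔪) F))))
    (hsq : ∀ (𝔮 : Ideal A) [𝔮.IsPrime], h₂ ∉ 𝔮 →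
      ι (Localization.AtPrime 𝔮) (algebraMap A (Localization.AtPrime 𝔮) F) =
          ι (Localization.AtPrime 𝔪) (algebraMap A (Localization.AtPrime 𝔪) F) →
        algebraMap A (Localization.AtPrime 𝔮) F ∈ maximalIdeal (Localization.AtPrime 𝔮) ^ 2)
    (𝔮 : Ideal A) [𝔮.IsPrime] (h𝔭𝔮 : 𝔭 ≤ 𝔮) (hh₁ : h₁ ∉ 𝔮) (hh₂ : h₂ ∉ 𝔮) :
    topStratum ι (Localization.AtPrime 𝔮) (algebraMap A (Localization.AtPrime 𝔮) F) =
      {𝔮₀' | 𝔭.map (algebraMap A (Localization.AtPrime 𝔮)) ≤ 𝔮₀'.asIdeal} := by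
  -- the value at `A_𝔮` is the value at `A_𝔪`
  have hι𝔮 : ι (Localization.AtPrime 𝔮) (algebraMap A (Localization.AtPrime 𝔮) F) =
      ι (Localization.AtPrime 𝔪) (algebraMap A (Localization.AtPrime 𝔪) F) := ((hiff 𝔮 hh₁).mp h𝔭𝔮).2
  ext 𝔮₀'
  have hle : 𝔮₀'.asIdeal.comap (algebraMap A (Localization.AtPrime 𝔮)) ≤ 𝔮 := comap_le_of_isPrime_atPrime 𝔮 _
  have hh₁' : h₁ ∉ 𝔮₀'.asIdeal.comap (algebraMap A (Localization.AtPrime 𝔮)) := fun h => hh₁ (hle h)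
  have hh₂' : h₂ ∉ 𝔮₀'.asIdeal.comap (algebraMap A (Localization.AtPrime 𝔮)) := fun h => hh₂ (hle h)
  rw [mem_topStratum_iff, StratumIff.iota_localization_localization_eq ι hiso 𝔮 𝔮₀'.asIdeal F, hι𝔮, Set.mem_setOf_eq,
    Ideal.map_le_iff_le_comap]
  constructor
  · intro heq
    exact ((hiff _ hh₁').mpr ⟨hsq _ hh₂' heq, heq⟩)
  · intro hle𝔭
    exact ((hiff _ hh₁').mp hle𝔭).2

/-! ## The (open″) body at a P3a position, `ι`-generic -/

/-- **(open″) BODY AT A P3a POSITION for the cylinder pair `(ι, jCylinder ι jContact)`, `ι`-generic.**  Position: `k`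
perfect, `A` of finite type, `𝔭 ≤ 𝔪` primes, `A_𝔪` and `A_𝔭` regular, `dim A_𝔭 = 2`, `(x, g) A_𝔭 = 𝔪_{A_𝔭}`,
`(x, g) A_𝔪 = 𝔭 A_𝔪`, `(x/1, g/1)` with independent differentials in `A_𝔪`; P2 data at `A_𝔭`; ι-side: the stratum iff on a
basic open `D(h₁) ∋ 𝔪` and «equal `ι` ⇒ `F ∈ 𝔪²`» on `D(h₂) ∋ 𝔪`.  Conclusion: some `h ∉ 𝔪` such that for every prime
`𝔮 ∌ h`: `(∀ i, (x, g)_i ∈ 𝔮) ↔ (F ∈ 𝔪_{A_𝔮}² ∧ ι (A_𝔮) F = ι (A_𝔪) F)`, and `(∀ i, (x, g)_i ∈ 𝔮) →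
jCylinder ι jContact (A_𝔮) (F/1) m = (x, g; 1, b_max)_m · A_𝔮` for all `m` — the literal two demands of
`JOpenPresentationForallSingLE d` (any `d`) with `U = ![x, g]`, `W = ![1, b_max]`, `b_max` read at `A_𝔭`.
[OURS · L1 W4.3 · (o28) (o28-O)] -/
theorem jOpenPresentation_body_cylinder (ι : (R : Type) → [CommRing R] → R → Ordinal.{0}) (hiso : IotaIsoInvariant ι)
    (k : Type) [Field k] [PerfectField k] (A : Type) [CommRing A] [Algebra k A] [Algebra.FiniteType k A]
    (𝔪 : Ideal A) [𝔪.IsPrime] [IsRegularLocalRing (Localization.AtPrime 𝔪)] (F : A)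
    (𝔭 : Ideal A) [𝔭.IsPrime] (h𝔭𝔪 : 𝔭 ≤ 𝔪) [IsRegularLocalRing (Localization.AtPrime 𝔭)]
    (hdim𝔭 : ringKrullDim (Localization.AtPrime 𝔭) = 2) (x g : A)
    (hxg𝔭 : (Ideal.span {x, g}).map (algebraMap A (Localization.AtPrime 𝔭)) = maximalIdeal (Localization.AtPrime 𝔭))
    (hxg𝔪 : (Ideal.span {x, g}).map (algebraMap A (Localization.AtPrime 𝔪)) = 𝔭.map (algebraMap A (Localization.AtPrime 𝔪)))
    (hU𝔪 : ∀ i, algebraMap A (Localization.AtPrime 𝔪) ((![x, g] : Fin 2 → A) i) ∈ maximalIdeal (Localization.AtPrime 𝔪))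
    (hli𝔪 : LinearIndependent (ResidueField (Localization.AtPrime 𝔪)) fun i =>
      (maximalIdeal (Localization.AtPrime 𝔪)).toCotangent ⟨algebraMap A _ ((![x, g] : Fin 2 → A) i), hU𝔪 i⟩)
    (hF0 : algebraMap A (Localization.AtPrime 𝔭) F ≠ 0)
    (hnm : ¬ IsMonomialType (algebraMap A (Localization.AtPrime 𝔭) F))
    (hreach : algebraMap A (Localization.AtPrime 𝔭) F ∈
      contactFiltration (algebraMap A (Localization.AtPrime 𝔭) g) (bMax (algebraMap A (Localization.AtPrime 𝔭) F))
        (bMax (algebraMap A (Localization.AtPrime 𝔭) F) * (adicOrder (algebraMap A (Localization.AtPrime 𝔭) F)).toNat))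
    {h₁ h₂ : A} (hh₁ : h₁ ∉ 𝔪) (hh₂ : h₂ ∉ 𝔪)
    (hiff : ∀ (𝔮 : Ideal A) [𝔮.IsPrime], h₁ ∉ 𝔮 →
      (𝔭 ≤ 𝔮 ↔ (algebraMap A (Localization.AtPrime 𝔮) F ∈ maximalIdeal (Localization.AtPrime 𝔮) ^ 2 ∧
        ι (Localization.AtPrime 𝔮) (algebraMap A (Localization.AtPrime 𝔮) F) =
          ι (Localization.AtPrime 𝔪) (algebraMap A (Localization.AtPrime 𝔪) F))))
    (hsq : ∀ (𝔮 : Ideal A) [𝔮.IsPrime], h₂ ∉ 𝔮 →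
      ι (Localization.AtPrime 𝔮) (algebraMap A (Localization.AtPrime 𝔮) F) =
          ι (Localization.AtPrime 𝔪) (algebraMap A (Localization.AtPrime 𝔪) F) →
        algebraMap A (Localization.AtPrime 𝔮) F ∈ maximalIdeal (Localization.AtPrime 𝔮) ^ 2) :
    ∃ h : A, h ∉ 𝔪 ∧ 1 ≤ bMax (algebraMap A (Localization.AtPrime 𝔭) F) ∧
      ∀ (𝔮 : Ideal A) [𝔮.IsPrime], h ∉ 𝔮 →
        ((∀ i, (![x, g] : Fin 2 → A) i ∈ 𝔮) ↔
          (algebraMap A (Localization.AtPrime 𝔮) F ∈ maximalIdeal (Localization.AtPrime 𝔮) ^ 2 ∧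
            ι (Localization.AtPrime 𝔮) (algebraMap A (Localization.AtPrime 𝔮) F) =
              ι (Localization.AtPrime 𝔪) (algebraMap A (Localization.AtPrime 𝔪) F))) ∧
        ((∀ i, (![x, g] : Fin 2 → A) i ∈ 𝔮) → ∀ m : ℕ,
          jCylinder ι jContact (Localization.AtPrime 𝔮) (algebraMap A (Localization.AtPrime 𝔮) F) m =
            (weightedMonomialIdeal ![x, g] ![1, bMax (algebraMap A (Localization.AtPrime 𝔭) F)] m).map
              (algebraMap A (Localization.AtPrime 𝔮))) := by
  classical
  haveI : IsNoetherianRing A := Algebra.FiniteType.isNoetherianRing k A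
  -- the P2 data at `A_𝔭`, unpacked
  have hxg' : Ideal.span {algebraMap A (Localization.AtPrime 𝔭) x, algebraMap A (Localization.AtPrime 𝔭) g} =
      maximalIdeal (Localization.AtPrime 𝔭) := by
    rw [← hxg𝔭, Ideal.map_span, Set.image_pair]
  have hmem : ∀ a : A, algebraMap A (Localization.AtPrime 𝔭) a ∈ maximalIdeal (Localization.AtPrime 𝔭) → a ∈ 𝔭 :=
    fun a ha => (IsLocalization.AtPrime.to_map_mem_maximal_iff (Localization.AtPrime 𝔭) 𝔭 a).mp ha
  have hx : x ∈ 𝔭 := hmem x (hxg' ▸ Ideal.subset_span (by simp))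
  have hg : g ∈ 𝔭 := hmem g (hxg' ▸ Ideal.subset_span (by simp))
  have hg2 := (LocalGameEFTSteepening.not_mem_sq_of_span_pair_eq (by exact_mod_cast hdim𝔭) hxg').2
  have hF2𝔭 := mem_sq_of_not_isMonomialType hF0 hnm ⟨_, hxg' ▸ Ideal.subset_span (by simp), hg2⟩
  have hb := (one_le_bMax_and_reaches_of_essFiniteType k (Localization.AtPrime 𝔭) hF0 hF2𝔭 hnm).1
  -- the `V(U)`-form of the stratum iff, `U = (x, g)`, all weights positive
  have hW : ∀ i, 0 < (![1, bMax (algebraMap A (Localization.AtPrime 𝔭) F)] : Fin 2 → ℕ) i :=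
    Fin.forall_fin_two.2 ⟨Nat.one_pos, hb⟩
  have hset : {y : A | ∃ i, 0 < (![1, bMax (algebraMap A (Localization.AtPrime 𝔭) F)] : Fin 2 → ℕ) i ∧
      y = (![x, g] : Fin 2 → A) i} = {x, g} := by
    ext y
    constructor
    · rintro ⟨i, -, rfl⟩
      fin_cases i <;> simp
    · rintro (rfl | rfl)
      · exact ⟨0, hW 0, rfl⟩
      · exact ⟨1, hW 1, rfl⟩
  have hmapU : (Ideal.span {y : A | ∃ i, 0 < (![1, bMax (algebraMap A (Localization.AtPrime 𝔭) F)] : Fin 2 → ℕ) i ∧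
      y = (![x, g] : Fin 2 → A) i}).map (algebraMap A (Localization.AtPrime 𝔪)) =
      𝔭.map (algebraMap A (Localization.AtPrime 𝔪)) := by
    rw [hset, hxg𝔪]
  have hcomap : (𝔭.map (algebraMap A (Localization.AtPrime 𝔪))).comap (algebraMap A (Localization.AtPrime 𝔪)) = 𝔭 :=
    comap_map_atPrime_of_le 𝔭 𝔪 h𝔭𝔪
  obtain ⟨ha, hha, hU⟩ := StratumIff.stratumIff_forall_mem_of_comap_of_pos 𝔪 ![x, g]
    ![1, bMax (algebraMap A (Localization.AtPrime 𝔭) F)] hW (𝔭.map (algebraMap A (Localization.AtPrime 𝔪))) hmapU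
    (fun q => algebraMap A (Localization.AtPrime q.asIdeal) F ∈ maximalIdeal (Localization.AtPrime q.asIdeal) ^ 2 ∧
      ι (Localization.AtPrime q.asIdeal) (algebraMap A (Localization.AtPrime q.asIdeal) F) =
        ι (Localization.AtPrime 𝔪) (algebraMap A (Localization.AtPrime 𝔪) F))
    ⟨h₁, hh₁, fun 𝔮 _ hh₁𝔮 => by rw [hcomap]; exact hiff 𝔮 hh₁𝔮⟩
  -- regularity of `A_𝔮` and independence of `(x/1, g/1)` spread from `𝔪`
  obtain ⟨f, hf𝔪, hspread⟩ := exists_notMem_forall_linearIndependent_toCotangent k 𝔪 (![x, g]) hU𝔪 hli𝔪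
  refine ⟨h₁ * h₂ * ha * f, fun hm => ?_, hb, fun 𝔮 _ hh𝔮 => ?_⟩
  · rcases Ideal.IsPrime.mem_or_mem ‹𝔪.IsPrime› hm with hm | hm
    · rcases Ideal.IsPrime.mem_or_mem ‹𝔪.IsPrime› hm with hm | hm
      · exact (Ideal.IsPrime.mem_or_mem ‹𝔪.IsPrime› hm).elim hh₁ hh₂
      · exact hha hm
    · exact hf𝔪 hm
  have hh₁𝔮 : h₁ ∉ 𝔮 := fun h => hh𝔮 (Ideal.mul_mem_right _ _ (Ideal.mul_mem_right _ _ (Ideal.mul_mem_right _ _ h)))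
  have hh₂𝔮 : h₂ ∉ 𝔮 := fun h => hh𝔮 (Ideal.mul_mem_right _ _ (Ideal.mul_mem_right _ _ (Ideal.mul_mem_left _ _ h)))
  have hha𝔮 : ha ∉ 𝔮 := fun h => hh𝔮 (Ideal.mul_mem_right _ _ (Ideal.mul_mem_left _ _ h))
  have hf𝔮 : f ∉ 𝔮 := fun h => hh𝔮 (Ideal.mul_mem_left _ _ h)
  refine ⟨hU 𝔮 hha𝔮, fun hU𝔮 m => ?_⟩
  -- at `𝔮 ∈ V(x, g) ∩ D(h)`: `𝔭 ≤ 𝔮`, `A_𝔮` regular, `(x/1, g/1)` independent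
  have h𝔭𝔮 : 𝔭 ≤ 𝔮 := (hiff 𝔮 hh₁𝔮).mpr ((hU 𝔮 hha𝔮).mp hU𝔮)
  obtain ⟨hreg𝔮, hXY𝔮, hli𝔮⟩ := hspread 𝔮 hf𝔮 hU𝔮
  haveI := hreg𝔮
  haveI := isPrime_map_atPrime_of_le 𝔭 𝔮 h𝔭𝔮
  have hXY : ∀ i, (![algebraMap A (Localization.AtPrime 𝔮) x, algebraMap A (Localization.AtPrime 𝔮) g] : Fin 2 → _) i ∈
      maximalIdeal (Localization.AtPrime 𝔮) := by
    intro i; fin_cases i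
    · exact hXY𝔮 0
    · exact hXY𝔮 1
  have hfun : (fun i => (maximalIdeal (Localization.AtPrime 𝔮)).toCotangent
        ⟨algebraMap A _ ((![x, g] : Fin 2 → A) i), hXY𝔮 i⟩) =
      (fun i => (maximalIdeal (Localization.AtPrime 𝔮)).toCotangent
        ⟨(![algebraMap A (Localization.AtPrime 𝔮) x, algebraMap A (Localization.AtPrime 𝔮) g] : Fin 2 → _) i,
          hXY i⟩) := by
    funext i; fin_cases i <;> rfl
  rw [hfun] at hli𝔮
  -- the top stratum of `A_𝔮` is `V(𝔭 A_𝔮)`, so `jCylinder` is the cylinder over `𝔭 A_𝔮`, presented by `(x, g; 1, b_max)`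
  have hE𝔮 := topStratum_atPrime_eq_of_stratumIff ι hiso 𝔪 𝔭 F hiff hsq 𝔮 h𝔭𝔮 hh₁𝔮 hh₂𝔮
  rw [jCylinder_eq_of_topStratum_eq ι jContact _ _ m hE𝔮,
    ← IsScalarTower.algebraMap_apply A (Localization.AtPrime 𝔮) _ F]
  exact cylinder_open_presentation A 𝔭 x g F hx hg hxg' hg2 hF0 hnm hreach hb 𝔮 h𝔭𝔮 hXY hli𝔮 m

/-! ## `ι = iotaOrd`: the ι-side inputs discharged from the local (strat) conjunct -/

/-- **(open″) BODY AT A P3a POSITION for the pair `(iotaOrd, jCylinder iotaOrd jContact)`.**  As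
`jOpenPresentation_body_cylinder`, with the ι-side inputs DISCHARGED from the LOCAL (strat) conjunct of `CanonicalGameClause`
at `S = A_𝔪` with centre `𝔭 A_𝔪` (res-type-073's form: for the primes `𝔭' ∋ F` of `A_𝔪`, `ord_{(A_𝔪)_{𝔭'}} F = ord_{A_𝔪} F ↔
𝔭 A_𝔪 ≤ 𝔭'`) and `0 ≠ F ∈ 𝔪² A_𝔪`: the stratum iff on a basic open is `GenericEquimultiplicity.stratumIff_iotaOrd` (p515109,
any dimension), and equality of orders forces `F ∈ 𝔪_{A_𝔮}²` (`StratumIff.mem_sq_iff_two_le_iotaOrd`).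
[OURS · L1 W4.3 · (o28) (o28-O)] -/
theorem jOpenPresentation_body_cylinder_iotaOrd
    (k : Type) [Field k] [PerfectField k] (A : Type) [CommRing A] [Algebra k A] [Algebra.FiniteType k A]
    (𝔪 : Ideal A) [𝔪.IsPrime] [h𝔪 : IsRegularLocalRing (Localization.AtPrime 𝔪)] (F : A)
    (hF0𝔪 : algebraMap A (Localization.AtPrime 𝔪) F ≠ 0)
    (hF2𝔪 : algebraMap A (Localization.AtPrime 𝔪) F ∈ maximalIdeal (Localization.AtPrime 𝔪) ^ 2)
    (𝔭 : Ideal A) [𝔭.IsPrime] (h𝔭𝔪 : 𝔭 ≤ 𝔪) [IsRegularLocalRing (Localization.AtPrime 𝔭)]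
    (hdim𝔭 : ringKrullDim (Localization.AtPrime 𝔭) = 2) (x g : A)
    (hxg𝔭 : (Ideal.span {x, g}).map (algebraMap A (Localization.AtPrime 𝔭)) = maximalIdeal (Localization.AtPrime 𝔭))
    (hxg𝔪 : (Ideal.span {x, g}).map (algebraMap A (Localization.AtPrime 𝔪)) = 𝔭.map (algebraMap A (Localization.AtPrime 𝔪)))
    (hU𝔪 : ∀ i, algebraMap A (Localization.AtPrime 𝔪) ((![x, g] : Fin 2 → A) i) ∈ maximalIdeal (Localization.AtPrime 𝔪))
    (hli𝔪 : LinearIndependent (ResidueField (Localization.AtPrime 𝔪)) fun i =>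
      (maximalIdeal (Localization.AtPrime 𝔪)).toCotangent ⟨algebraMap A _ ((![x, g] : Fin 2 → A) i), hU𝔪 i⟩)
    (hF0 : algebraMap A (Localization.AtPrime 𝔭) F ≠ 0)
    (hnm : ¬ IsMonomialType (algebraMap A (Localization.AtPrime 𝔭) F))
    (hreach : algebraMap A (Localization.AtPrime 𝔭) F ∈
      contactFiltration (algebraMap A (Localization.AtPrime 𝔭) g) (bMax (algebraMap A (Localization.AtPrime 𝔭) F))
        (bMax (algebraMap A (Localization.AtPrime 𝔭) F) * (adicOrder (algebraMap A (Localization.AtPrime 𝔭) F)).toNat))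
    (hstrat : ∀ (𝔭' : Ideal (Localization.AtPrime 𝔪)) [𝔭'.IsPrime],
      algebraMap A (Localization.AtPrime 𝔪) F ∈ 𝔭' →
        (iotaOrd (Localization.AtPrime 𝔭') (algebraMap (Localization.AtPrime 𝔪) (Localization.AtPrime 𝔭')
            (algebraMap A (Localization.AtPrime 𝔪) F)) =
          iotaOrd (Localization.AtPrime 𝔪) (algebraMap A (Localization.AtPrime 𝔪) F) ↔
            𝔭.map (algebraMap A (Localization.AtPrime 𝔪)) ≤ 𝔭')) :
    ∃ h : A, h ∉ 𝔪 ∧ 1 ≤ bMax (algebraMap A (Localization.AtPrime 𝔭) F) ∧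
      ∀ (𝔮 : Ideal A) [𝔮.IsPrime], h ∉ 𝔮 →
        ((∀ i, (![x, g] : Fin 2 → A) i ∈ 𝔮) ↔
          (algebraMap A (Localization.AtPrime 𝔮) F ∈ maximalIdeal (Localization.AtPrime 𝔮) ^ 2 ∧
            iotaOrd (Localization.AtPrime 𝔮) (algebraMap A (Localization.AtPrime 𝔮) F) =
              iotaOrd (Localization.AtPrime 𝔪) (algebraMap A (Localization.AtPrime 𝔪) F))) ∧
        ((∀ i, (![x, g] : Fin 2 → A) i ∈ 𝔮) → ∀ m : ℕ,
          jCylinder iotaOrd jContact (Localization.AtPrime 𝔮) (algebraMap A (Localization.AtPrime 𝔮) F) m =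
            (weightedMonomialIdeal ![x, g] ![1, bMax (algebraMap A (Localization.AtPrime 𝔭) F)] m).map
              (algebraMap A (Localization.AtPrime 𝔮))) := by
  haveI := isPrime_map_atPrime_of_le 𝔭 𝔪 h𝔭𝔪
  -- `F ∈ 𝔭` (the P2 data put `F/1` in `𝔪²_{A_𝔭}`)
  have hxg' : Ideal.span {algebraMap A (Localization.AtPrime 𝔭) x, algebraMap A (Localization.AtPrime 𝔭) g} =
      maximalIdeal (Localization.AtPrime 𝔭) := by
    rw [← hxg𝔭, Ideal.map_span, Set.image_pair]
  have hg2 := (LocalGameEFTSteepening.not_mem_sq_of_span_pair_eq (by exact_mod_cast hdim𝔭) hxg').2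
  have hF2𝔭 := mem_sq_of_not_isMonomialType hF0 hnm ⟨_, hxg' ▸ Ideal.subset_span (by simp), hg2⟩
  have hF𝔭 : F ∈ 𝔭 :=
    (IsLocalization.AtPrime.to_map_mem_maximal_iff (Localization.AtPrime 𝔭) 𝔭 F).mp (Ideal.pow_le_self two_ne_zero hF2𝔭)
  -- the order at `A_𝔪` is `≥ 2`
  have h2 : (2 : Ordinal) ≤ iotaOrd (Localization.AtPrime 𝔪) (algebraMap A (Localization.AtPrime 𝔪) F) :=
    (StratumIff.mem_sq_iff_two_le_iotaOrd F 𝔪).mp hF2𝔪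
  -- (adm) along the centre `𝔭 A_𝔪`: the order stays `≥ 2`
  have hadm : ∀ (Q : Ideal (Localization.AtPrime 𝔪)) [Q.IsPrime], 𝔭.map (algebraMap A (Localization.AtPrime 𝔪)) ≤ Q →
      algebraMap (Localization.AtPrime 𝔪) (Localization.AtPrime Q) (algebraMap A (Localization.AtPrime 𝔪) F) ∈
        maximalIdeal (Localization.AtPrime Q) ^ 2 := by
    intro Q _ hQ
    have hFQ : algebraMap A (Localization.AtPrime 𝔪) F ∈ Q := hQ (Ideal.mem_map_of_mem _ hF𝔭)
    have heq := (hstrat Q hFQ).mpr hQ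
    rw [StratumIff.mem_sq_localization_localization_iff 𝔪 Q F, StratumIff.mem_sq_iff_two_le_iotaOrd,
      ← StratumIff.iota_localization_localization_eq iotaOrd iotaOrd_isoInvariant 𝔪 Q F, heq]
    exact h2
  obtain ⟨h₁, hh₁, hiff⟩ := GenericEquimultiplicity.stratumIff_iotaOrd k 𝔪 F h𝔪 hF0𝔪
    (𝔭.map (algebraMap A (Localization.AtPrime 𝔪))) (fun 𝔭' _ hF => hstrat 𝔭' hF) hadm
  have hcomap : (𝔭.map (algebraMap A (Localization.AtPrime 𝔪))).comap (algebraMap A (Localization.AtPrime 𝔪)) = 𝔭 :=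
    comap_map_atPrime_of_le 𝔭 𝔪 h𝔭𝔪
  rw [hcomap] at hiff
  refine jOpenPresentation_body_cylinder iotaOrd iotaOrd_isoInvariant k A 𝔪 F 𝔭 h𝔭𝔪 hdim𝔭 x g hxg𝔭 hxg𝔪 hU𝔪 hli𝔪
    hF0 hnm hreach hh₁ (show (1 : A) ∉ 𝔪 from fun h1 => Ideal.IsPrime.ne_top ‹_› ((Ideal.eq_top_iff_one _).mpr h1))
    hiff ?_
  intro 𝔮 _ _ heq
  rw [StratumIff.mem_sq_iff_two_le_iotaOrd, heq]
  exact h2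

/-- **The literal ∃-body of `JOpenPresentationForallSingLE d p iotaOrd (jCylinder iotaOrd jContact)` at a P3a position**
(any `d`; the dimension guard `dim A_𝔮 ≤ d` is not used): `N = 2`, `U = ![x, g]`, `W = ![1, b_max]`
(`jOpenPresentation_body_cylinder_iotaOrd` repackaged in res-type-061's clause shape, p522114). [OURS · L1 W4.3 · (o28) (o28-O)] -/
theorem jOpenPresentationLE_body_cylinder_iotaOrd (d : ℕ)
    (k : Type) [Field k] [PerfectField k] (A : Type) [CommRing A] [Algebra k A] [Algebra.FiniteType k A]
    (𝔪 : Ideal A) [𝔪.IsPrime] [h𝔪 : IsRegularLocalRing (Localization.AtPrime 𝔪)] (F : A)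
    (hF0𝔪 : algebraMap A (Localization.AtPrime 𝔪) F ≠ 0)
    (hF2𝔪 : algebraMap A (Localization.AtPrime 𝔪) F ∈ maximalIdeal (Localization.AtPrime 𝔪) ^ 2)
    (𝔭 : Ideal A) [𝔭.IsPrime] (h𝔭𝔪 : 𝔭 ≤ 𝔪) [IsRegularLocalRing (Localization.AtPrime 𝔭)]
    (hdim𝔭 : ringKrullDim (Localization.AtPrime 𝔭) = 2) (x g : A)
    (hxg𝔭 : (Ideal.span {x, g}).map (algebraMap A (Localization.AtPrime 𝔭)) = maximalIdeal (Localization.AtPrime 𝔭))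
    (hxg𝔪 : (Ideal.span {x, g}).map (algebraMap A (Localization.AtPrime 𝔪)) = 𝔭.map (algebraMap A (Localization.AtPrime 𝔪)))
    (hU𝔪 : ∀ i, algebraMap A (Localization.AtPrime 𝔪) ((![x, g] : Fin 2 → A) i) ∈ maximalIdeal (Localization.AtPrime 𝔪))
    (hli𝔪 : LinearIndependent (ResidueField (Localization.AtPrime 𝔪)) fun i =>
      (maximalIdeal (Localization.AtPrime 𝔪)).toCotangent ⟨algebraMap A _ ((![x, g] : Fin 2 → A) i), hU𝔪 i⟩)
    (hF0 : algebraMap A (Localization.AtPrime 𝔭) F ≠ 0)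
    (hnm : ¬ IsMonomialType (algebraMap A (Localization.AtPrime 𝔭) F))
    (hreach : algebraMap A (Localization.AtPrime 𝔭) F ∈
      contactFiltration (algebraMap A (Localization.AtPrime 𝔭) g) (bMax (algebraMap A (Localization.AtPrime 𝔭) F))
        (bMax (algebraMap A (Localization.AtPrime 𝔭) F) * (adicOrder (algebraMap A (Localization.AtPrime 𝔭) F)).toNat))
    (hstrat : ∀ (𝔭' : Ideal (Localization.AtPrime 𝔪)) [𝔭'.IsPrime],
      algebraMap A (Localization.AtPrime 𝔪) F ∈ 𝔭' →
        (iotaOrd (Localization.AtPrime 𝔭') (algebraMap (Localization.AtPrime 𝔪) (Localization.AtPrime 𝔭')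
            (algebraMap A (Localization.AtPrime 𝔪) F)) =
          iotaOrd (Localization.AtPrime 𝔪) (algebraMap A (Localization.AtPrime 𝔪) F) ↔
            𝔭.map (algebraMap A (Localization.AtPrime 𝔪)) ≤ 𝔭')) :
    ∃ h : A, h ∉ 𝔪 ∧ ∃ (N : ℕ) (U : Fin N → A) (W : Fin N → ℕ), (∀ i, 0 < W i) ∧
      (∃ hU : ∀ i, algebraMap A (Localization.AtPrime 𝔪) (U i) ∈ maximalIdeal (Localization.AtPrime 𝔪),
        LinearIndependent (ResidueField (Localization.AtPrime 𝔪))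
          (fun i => ((maximalIdeal (Localization.AtPrime 𝔪)).toCotangent ⟨_, hU i⟩ :
            CotangentSpace (Localization.AtPrime 𝔪)))) ∧
      ∀ (𝔮 : Ideal A) [𝔮.IsPrime], h ∉ 𝔮 → ringKrullDim (Localization.AtPrime 𝔮) ≤ d →
        ((∀ i, U i ∈ 𝔮) ↔
          (algebraMap A (Localization.AtPrime 𝔮) F ∈ (maximalIdeal (Localization.AtPrime 𝔮)) ^ 2 ∧
            iotaOrd (Localization.AtPrime 𝔮) (algebraMap A (Localization.AtPrime 𝔮) F) =
              iotaOrd (Localization.AtPrime 𝔪) (algebraMap A (Localization.AtPrime 𝔪) F))) ∧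
        ((∀ i, U i ∈ 𝔮) → ∀ m : ℕ,
          jCylinder iotaOrd jContact (Localization.AtPrime 𝔮) (algebraMap A (Localization.AtPrime 𝔮) F) m =
            (weightedMonomialIdeal U W m).map (algebraMap A (Localization.AtPrime 𝔮))) := by
  obtain ⟨h, hh, hb, H⟩ := jOpenPresentation_body_cylinder_iotaOrd k A 𝔪 F hF0𝔪 hF2𝔪 𝔭 h𝔭𝔪 hdim𝔭 x g hxg𝔭 hxg𝔪
    hU𝔪 hli𝔪 hF0 hnm hreach hstrat
  exact ⟨h, hh, 2, ![x, g], ![1, bMax (algebraMap A (Localization.AtPrime 𝔭) F)],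
    Fin.forall_fin_two.2 ⟨Nat.one_pos, hb⟩, ⟨hU𝔪, hli𝔪⟩, fun 𝔮 _ hh𝔮 _ => H 𝔮 hh𝔮⟩

end ContactCylinder

end Summit.ResolutionOfSingularities.ResolutionOfSingularities.Theorems

end
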